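import Summits.CriticalPhenomena.PercolationContinuityZ3.Theorems.Transplant.FKDoubleFanWord
import HarnessLib

/-!
# Double fans `K₂ ∨ P_{m+1}`: the moving-boundary cluster-count invariant and the transfer formula at RIGID weights

Support file (`--supports stmt-CriticalPhenomena-4575`), FK sub-lane `prim-bschramm-fk-3` (gen 20); builds on p205010 (kernel theorem, internal
audit signed; external expert review pending).  No named facts, no sorries; standard axioms.  Memo `bschramm/prim-bschramm-fk-3/DOUBLE-FAN.md` §8.
Layer 1b of the measure-level bridge for double fans (`…DoubleFanWord`): **`dfConf_inv`** — for the rigid configuration `conf_j` (axis + stars of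
`c 0, …, c j`), `k(conf_j) + j + 3 = blocks(π_j) + closed_j + card V`, apex/rim reachability in `conf_j` is read off `π_j = dfState j`, and the
later rim vertices are fresh — by `clusterCount_attach` / `reachable_union_star` of `…ThreeApexClusterCount/Clusters` applied to the moving triple
`(a, b, c_j)` (block `0` uses the virtual triple `(a, b, b)`); and **`rcPartitionFunctionW_eq_transferDF_rigid`**: `Z_w = transferDF` whenever
`w` is supported on the double-fan pairs and every weight is `0` or `1` (`card V = m + 3`).
[cite: Grimmett2006, §1.4 eq. (1.20) (p. 15); §1.2 eq. (1.1) (p. 4)] [folklore]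
-/

noncomputable section

namespace Summit.CriticalPhenomena.PercolationContinuityZ3.Theorems

namespace FK

namespace ThreeApex

open Literature.Probability.LatticeModels Literature.Probability.Percolation
open scoped Classical

variable {V : Type*} [Fintype V]

section Setting

variable {a b : V} {c : ℕ → V} {m : ℕ}
variable (hab : a ≠ b) (hinj : ∀ j k, j ≤ m → k ≤ m → c j = c k → j = k) (hca : ∀ j, j ≤ m → c j ≠ a) (hcb : ∀ j, j ≤ m → c j ≠ b)
include hab hinj hca hcb

omit [Fintype V] hab hinj hca hcb in
/-- The axis configuration: its pairs join `a` and `b` only. [folklore] -/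
theorem axisConf_fresh (t : Bool) (u : V) (hua : u ≠ a) (hub : u ≠ b) : ∀ e ∈ (if t then ({s(a, b)} : Finset (Sym2 V)) else ∅), u ∉ e := by
  intro e he
  cases t
  · simp at he
  · simp only [↓reduceIte, Finset.mem_singleton] at he
    subst he
    rw [Sym2.mem_iff, not_or]; exact ⟨hua, hub⟩

omit [Fintype V] hinj hca hcb in
/-- Reachability in the axis configuration: `a ~ b` iff the axis is open; `b ~ b`. [folklore] -/
theorem reach_axisConf_ab (t : Bool) :
    ((openGraph (↑(if t then ({s(a, b)} : Finset (Sym2 V)) else ∅) : BondConfig V)).Reachable a b ↔ t = true) := by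
  cases t
  · simp only [Bool.false_eq_true, ↓reduceIte, iff_false, reachable_empty_iff]; exact hab
  · simp only [↓reduceIte, iff_true]
    rw [← Finset.insert_empty, Wheel.reachable_coe_insert_iff]
    exact Or.inr (Or.inl ⟨(reachable_empty_iff a a).2 rfl, (reachable_empty_iff b b).2 rfl⟩)

omit hinj hca hcb in
/-- Cluster count of the axis configuration: `card V − [t]`. [cite: Grimmett2006, §1.2 eq. (1.1) (p. 4)] -/
theorem clusterCount_axisConf (t : Bool) :
    clusterCount (↑(if t then ({s(a, b)} : Finset (Sym2 V)) else ∅) : BondConfig V) (∅ : Set V) + (if t then 1 else 0) = Fintype.card V := by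
  cases t
  · simp only [Bool.false_eq_true, ↓reduceIte, add_zero]; exact Wheel.clusterCount_emptyFinset
  · simp only [↓reduceIte]
    have h := Wheel.clusterCount_insert_free (∅ : Finset (Sym2 V)) a b
    rw [if_neg (by rw [reachable_empty_iff]; exact hab), Wheel.clusterCount_emptyFinset, Finset.insert_empty] at h
    exact h

/-- **The moving-boundary invariant** (all `j ≤ m`): (count) `k(conf_j) + j + [t] + 1 = card V + ... `, precisely
`k(conf_j) + j + 3 = blocks(π_j) + closed_j + card V`; (reach) reachability among `a, b, c_j` in `conf_j` is read off `π_j = dfState j`;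
(fresh) the rim vertices `c k`, `j < k ≤ m`, are met by no pair of `conf_j`. [cite: Grimmett2006, §1.2 eq. (1.1) (p. 4)] -/
theorem dfConf_inv (d : DFData) : ∀ j, j ≤ m →
    clusterCount (↑(dfConf a b c d j) : BondConfig V) (∅ : Set V) + j + 3 = (dfState d j).blocks + dfClosed d j + Fintype.card V ∧
    ((openGraph (↑(dfConf a b c d j) : BondConfig V)).Reachable a b ↔ (dfState d j).rAB = true) ∧
    ((openGraph (↑(dfConf a b c d j) : BondConfig V)).Reachable a (c j) ↔ (dfState d j).rAC = true) ∧
    ((openGraph (↑(dfConf a b c d j) : BondConfig V)).Reachable b (c j) ↔ (dfState d j).rBC = true) ∧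
    (∀ k, j < k → k ≤ m → ∀ e ∈ dfConf a b c d j, c k ∉ e) := by
  -- the generic step, used for `j = 0` (virtual boundary `(a, b, b)`) and for `j + 1`
  have step : ∀ (ω : Finset (Sym2 V)) (co u : V) (π : P3) (x y z : Bool) (K : ℕ),
      (∀ e ∈ ω, u ∉ e) → u ≠ a → u ≠ b → u ≠ co →
      ((openGraph (↑ω : BondConfig V)).Reachable a b ↔ π.rAB = true) →
      ((openGraph (↑ω : BondConfig V)).Reachable a co ↔ π.rAC = true) →
      ((openGraph (↑ω : BondConfig V)).Reachable b co ↔ π.rBC = true) →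
      clusterCount (↑ω : BondConfig V) (∅ : Set V) + K = π.blocks + Fintype.card V →
      clusterCount (↑(ω ∪ star u (attFin a b co x y z)) : BondConfig V) (∅ : Set V) + K + 1 =
          (π.dfStep x y z).blocks + (if π.rimQ z then 1 else 0) + Fintype.card V ∧
      ((openGraph (↑(ω ∪ star u (attFin a b co x y z)) : BondConfig V)).Reachable a b ↔ (π.dfStep x y z).rAB = true) ∧
      ((openGraph (↑(ω ∪ star u (attFin a b co x y z)) : BondConfig V)).Reachable a u ↔ (π.dfStep x y z).rAC = true) ∧
      ((openGraph (↑(ω ∪ star u (attFin a b co x y z)) : BondConfig V)).Reachable b u ↔ (π.dfStep x y z).rBC = true) := by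
    intro ω co u π x y z K hu hua hub huc hrab hrac hrbc hK
    have huA : u ∉ attFin a b co x y z := by
      rw [mem_attFin]; push Not; exact ⟨fun _ => hua, fun _ => hub, fun _ => huc⟩
    have RS := reachable_union_star ω hu (attFin a b co x y z) huA
    have hcnt := clusterCount_attach a b co ω hu hua hub huc x y z π.rAB π.rAC π.rBC hrab hrac hrbc
    have hblk := P3.blocks_dfStep π x y z
    have hdec : π.dec x y z = (if x then 1 else 0) + (if y then (if x && π.rAB then 0 else 1) else 0) +
        (if z then (if (x && π.rAC) || (y && π.rBC) then 0 else 1) else 0) := rfl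
    have haa : (openGraph (↑ω : BondConfig V)).Reachable a a ↔ True := iff_true_intro (SimpleGraph.Reachable.refl _)
    have hbb : (openGraph (↑ω : BondConfig V)).Reachable b b ↔ True := iff_true_intro (SimpleGraph.Reachable.refl _)
    have hba : (openGraph (↑ω : BondConfig V)).Reachable b a ↔ π.rAB = true := by rw [SimpleGraph.reachable_comm]; exact hrab
    have hcoa : (openGraph (↑ω : BondConfig V)).Reachable co a ↔ π.rAC = true := by rw [SimpleGraph.reachable_comm]; exact hrac
    have hcob : (openGraph (↑ω : BondConfig V)).Reachable co b ↔ π.rBC = true := by rw [SimpleGraph.reachable_comm]; exact hrbc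
    refine ⟨by omega, ?_, ?_, ?_⟩
    · rw [P3.rAB_dfStep, P3.rAB_attach, RS.1 a b hua.symm hub.symm]
      simp only [exists_mem_attFin, hrab, hrac, hcob, haa, hbb]
      rcases Bool.eq_false_or_eq_true x with h1 | h1 <;> rcases Bool.eq_false_or_eq_true y with h2 | h2 <;>
        rcases Bool.eq_false_or_eq_true z with h3 | h3 <;> rcases Bool.eq_false_or_eq_true π.rAB with h4 | h4 <;>
        rcases Bool.eq_false_or_eq_true π.rAC with h5 | h5 <;> rcases Bool.eq_false_or_eq_true π.rBC with h6 | h6 <;>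
        simp [h1, h2, h3, h4, h5, h6]
    · rw [P3.rAC_dfStep, RS.2 a hua.symm]
      simp only [exists_mem_attFin, haa, hrab, hrac]
      rcases Bool.eq_false_or_eq_true x with h1 | h1 <;> rcases Bool.eq_false_or_eq_true y with h2 | h2 <;>
        rcases Bool.eq_false_or_eq_true z with h3 | h3 <;> rcases Bool.eq_false_or_eq_true π.rAB with h4 | h4 <;>
        rcases Bool.eq_false_or_eq_true π.rAC with h5 | h5 <;> simp [h1, h2, h3, h4, h5]
    · rw [P3.rBC_dfStep, RS.2 b hub.symm]
      simp only [exists_mem_attFin, hba, hbb, hrbc]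
      rcases Bool.eq_false_or_eq_true x with h1 | h1 <;> rcases Bool.eq_false_or_eq_true y with h2 | h2 <;>
        rcases Bool.eq_false_or_eq_true z with h3 | h3 <;> rcases Bool.eq_false_or_eq_true π.rAB with h4 | h4 <;>
        rcases Bool.eq_false_or_eq_true π.rBC with h6 | h6 <;> simp [h1, h2, h3, h4, h6]
  intro j
  induction j with
  | zero =>
    intro _
    -- block 0 from the virtual boundary `(a, b, b)`
    set ω₀ : Finset (Sym2 V) := (if d.t then {s(a, b)} else ∅) with hω₀
    set π₀ : P3 := (if d.t then P3.top else P3.bc) with hπ₀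
    have h0a := hca 0 (Nat.zero_le _); have h0b := hcb 0 (Nat.zero_le _)
    have hfresh0 : ∀ e ∈ ω₀, c 0 ∉ e := axisConf_fresh d.t (c 0) h0a h0b
    have hrab0 : (openGraph (↑ω₀ : BondConfig V)).Reachable a b ↔ π₀.rAB = true := by
      rw [hω₀, reach_axisConf_ab hab]; rw [hπ₀]; cases d.t <;> decide
    have hrac0 : (openGraph (↑ω₀ : BondConfig V)).Reachable a b ↔ π₀.rAC = true := by
      rw [hω₀, reach_axisConf_ab hab]; rw [hπ₀]; cases d.t <;> decide
    have hrbc0 : (openGraph (↑ω₀ : BondConfig V)).Reachable b b ↔ π₀.rBC = true := by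
      rw [hπ₀]
      refine ⟨fun _ => by cases d.t <;> decide, fun _ => SimpleGraph.Reachable.refl _⟩
    have hK0 : clusterCount (↑ω₀ : BondConfig V) (∅ : Set V) + 2 = π₀.blocks + Fintype.card V := by
      have h := clusterCount_axisConf (V := V) hab d.t
      revert h
      rw [hω₀, hπ₀]
      cases d.t <;> (simp only [Bool.false_eq_true, ↓reduceIte, P3.blocks]; intro h; omega)
    obtain ⟨s1, s2, s3, s4⟩ := step ω₀ b (c 0) π₀ (d.x 0) (d.y 0) false 2 hfresh0 h0a h0b h0b hrab0 hrac0 hrbc0 hK0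
    have hconf : dfConf a b c d 0 = ω₀ ∪ star (c 0) (attFin a b b (d.x 0) (d.y 0) false) := rfl
    have hstate : dfState d 0 = π₀.dfStep (d.x 0) (d.y 0) false := rfl
    have hQ : π₀.rimQ false = false := by rw [hπ₀]; cases d.t <;> decide
    rw [hQ] at s1
    simp only [Bool.false_eq_true, ↓reduceIte, add_zero] at s1
    refine ⟨?_, ?_, ?_, ?_, ?_⟩
    · rw [hconf, hstate]; simp only [dfClosed]; omega
    · rw [hconf, hstate]; exact s2
    · rw [hconf, hstate]; exact s3
    · rw [hconf, hstate]; exact s4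
    · intro k hk hkm e he hck
      rw [hconf, Finset.mem_union] at he
      rcases he with he | he
      · exact axisConf_fresh d.t (c k) (hca k hkm) (hcb k hkm) e he hck
      · have hne : c k ≠ c 0 := fun h => absurd (hinj k 0 hkm (Nat.zero_le _) h) (by omega)
        have hkA : c k ∉ attFin a b b (d.x 0) (d.y 0) false := by
          rw [mem_attFin]; push Not; exact ⟨fun _ => hca k hkm, fun _ => hcb k hkm, fun h => absurd h (by decide)⟩
        rw [mem_star_iff] at he
        obtain ⟨p, hp, rfl⟩ := he
        rcases Sym2.mem_iff.1 hck with h | h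
        · exact hkA (h ▸ hp)
        · exact hne h
  | succ j ih =>
    intro hj
    have hj' : j < m := Nat.lt_of_succ_le hj
    obtain ⟨ihk, ihab, ihac, ihbc, ihfresh⟩ := ih hj'.le
    set ω := dfConf a b c d j with hω
    set π := dfState d j with hπ
    have hu : ∀ e ∈ ω, c (j + 1) ∉ e := ihfresh (j + 1) (Nat.lt_succ_self j) hj
    have hua : c (j + 1) ≠ a := hca (j + 1) hj
    have hub : c (j + 1) ≠ b := hcb (j + 1) hj
    have huc : c (j + 1) ≠ c j := fun h => absurd (hinj (j + 1) j hj hj'.le h) (by omega)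
    have hK : clusterCount (↑ω : BondConfig V) (∅ : Set V) + (j + 3 - dfClosed d j) = π.blocks + Fintype.card V := by
      have : dfClosed d j ≤ j + 3 := by
        -- `dfClosed j ≤ j`
        suffices h : ∀ i, dfClosed d i ≤ i by exact (h j).trans (by omega)
        intro i; induction i with
        | zero => simp [dfClosed]
        | succ i ih2 => simp only [dfClosed]; split_ifs <;> omega
      omega
    obtain ⟨s1, s2, s3, s4⟩ := step ω (c j) (c (j + 1)) π (d.x (j + 1)) (d.y (j + 1)) (d.z j) (j + 3 - dfClosed d j) hu hua hub huc
      ihab ihac ihbc hK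
    have hconf : dfConf a b c d (j + 1) = ω ∪ star (c (j + 1)) (attFin a b (c j) (d.x (j + 1)) (d.y (j + 1)) (d.z j)) := rfl
    have hstate : dfState d (j + 1) = π.dfStep (d.x (j + 1)) (d.y (j + 1)) (d.z j) := rfl
    have hclosed : dfClosed d (j + 1) = dfClosed d j + (if π.rimQ (d.z j) then 1 else 0) := rfl
    refine ⟨?_, ?_, ?_, ?_, ?_⟩
    · rw [hconf, hstate, hclosed]
      have : dfClosed d j ≤ j + 3 := by
        suffices h : ∀ i, dfClosed d i ≤ i by exact (h j).trans (by omega)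
        intro i; induction i with
        | zero => simp [dfClosed]
        | succ i ih2 => simp only [dfClosed]; split_ifs <;> omega
      omega
    · rw [hconf, hstate]; exact s2
    · rw [hconf, hstate]; exact s3
    · rw [hconf, hstate]; exact s4
    · intro k hk hkm e he hck
      rw [hconf, Finset.mem_union] at he
      rcases he with he | he
      · exact ihfresh k (by omega) hkm e he hck
      · have hne : c k ≠ c (j + 1) := fun h => absurd (hinj k (j + 1) hkm hj h) (by omega)
        have hkA : c k ∉ attFin a b (c j) (d.x (j + 1)) (d.y (j + 1)) (d.z j) := by
          rw [mem_attFin]; push Not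
          exact ⟨fun _ => hca k hkm, fun _ => hcb k hkm, fun _ h => absurd (hinj k j hkm hj'.le h) (by omega)⟩
        rw [mem_star_iff] at he
        obtain ⟨p, hp, rfl⟩ := he
        rcases Sym2.mem_iff.1 hck with h | h
        · exact hkA (h ▸ hp)
        · exact hne h

/-! ### The transfer formula at rigid weight vectors -/

/-- **The double-fan transfer formula at a rigid weight vector** (`card V = m + 3`: the vertices are `a, b, c 0, …, c m`). [cite: Grimmett2006, §1.4 eq. (1.20) (p. 15)] -/
theorem rcPartitionFunctionW_eq_transferDF_rigid (hcard : Fintype.card V = m + 3) (q : ℝ) (w : Sym2 V → unitInterval)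
    (hsupp : ∀ e, e ∉ dfPairs a b c m → w e = 0)
    (hrig : ∀ e ∈ dfPairs a b c m, ((w e : unitInterval) : ℝ) = 0 ∨ ((w e : unitInterval) : ℝ) = 1) :
    rcPartitionFunctionW w q ∅ = transferDF q w a b c m := by
  have hR : ∀ e : Sym2 V, ((w e : unitInterval) : ℝ) = 0 ∨ ((w e : unitInterval) : ℝ) = 1 := by
    intro e
    by_cases he : e ∈ dfPairs a b c m
    · exact hrig e he
    · left; rw [hsupp e he]; rfl
  have hbR : ∀ e : Sym2 V, ((w e : unitInterval) : ℝ) = bR (decide (((w e : unitInterval) : ℝ) = 1)) := by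
    intro e
    rcases hR e with h | h
    · rw [h]; simp [bR]
    · rw [h]; simp [bR]
  -- Boolean data
  set d : DFData := ⟨decide (wR w s(a, b) = 1), fun j => decide (wR w s(a, c j) = 1), fun j => decide (wR w s(b, c j) = 1),
    fun j => decide (wR w s(c j, c (j + 1)) = 1)⟩ with hd
  have ht : wR w s(a, b) = bR d.t := hbR _
  have hx : ∀ j, wR w s(a, c j) = bR (d.x j) := fun j => hbR _
  have hy : ∀ j, wR w s(b, c j) = bR (d.y j) := fun j => hbR _
  have hz : ∀ j, wR w s(c j, c (j + 1)) = bR (d.z j) := fun j => hbR _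
  rw [transferDF_rigid q w a b c d m ht hx hy hz]
  -- the rigid configuration is `dfConf m`
  have hmem : ∀ j, j ≤ m → ∀ e : Sym2 V, e ∈ dfConf a b c d j ↔
      (d.t = true ∧ e = s(a, b)) ∨ (∃ i, i ≤ j ∧ ((d.x i = true ∧ e = s(a, c i)) ∨ (d.y i = true ∧ e = s(b, c i)))) ∨
        (∃ i, i < j ∧ d.z i = true ∧ e = s(c i, c (i + 1))) := by
    intro j
    induction j with
    | zero =>
      intro _ e
      have hax : e ∈ (if d.t then ({s(a, b)} : Finset (Sym2 V)) else ∅) ↔ (d.t = true ∧ e = s(a, b)) := by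
        cases d.t <;> simp
      rw [dfConf, Finset.mem_union, hax, mem_star_iff, exists_mem_attFin]
      constructor
      · rintro (h | ⟨h, rfl⟩ | ⟨h, rfl⟩ | ⟨h, _⟩)
        · exact Or.inl h
        · exact Or.inr (Or.inl ⟨0, le_rfl, Or.inl ⟨h, rfl⟩⟩)
        · exact Or.inr (Or.inl ⟨0, le_rfl, Or.inr ⟨h, rfl⟩⟩)
        · exact absurd h (by decide)
      · rintro (h | ⟨i, hi, h⟩ | ⟨i, hi, _⟩)
        · exact Or.inl h
        · obtain rfl : i = 0 := Nat.le_zero.1 hi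
          rcases h with ⟨h, rfl⟩ | ⟨h, rfl⟩
          · exact Or.inr (Or.inl ⟨h, rfl⟩)
          · exact Or.inr (Or.inr (Or.inl ⟨h, rfl⟩))
        · exact absurd hi (Nat.not_lt_zero _)
    | succ j ih =>
      intro hj e
      simp only [dfConf, Finset.mem_union]
      rw [ih (by omega), mem_star_iff, exists_mem_attFin]
      constructor
      · rintro ((h | ⟨i, hi, h⟩ | ⟨i, hi, h⟩) | (⟨h, rfl⟩ | ⟨h, rfl⟩ | ⟨h, rfl⟩))
        · exact Or.inl h
        · exact Or.inr (Or.inl ⟨i, by omega, h⟩)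
        · exact Or.inr (Or.inr ⟨i, by omega, h⟩)
        · exact Or.inr (Or.inl ⟨j + 1, le_rfl, Or.inl ⟨h, rfl⟩⟩)
        · exact Or.inr (Or.inl ⟨j + 1, le_rfl, Or.inr ⟨h, rfl⟩⟩)
        · exact Or.inr (Or.inr ⟨j, by omega, h, rfl⟩)
      · rintro (h | ⟨i, hi, h⟩ | ⟨i, hi, h, rfl⟩)
        · exact Or.inl (Or.inl h)
        · rcases Nat.lt_succ_iff_lt_or_eq.1 (Nat.lt_succ_of_le hi) with hi' | rfl
          · exact Or.inl (Or.inr (Or.inl ⟨i, by omega, h⟩))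
          · rcases h with ⟨h, rfl⟩ | ⟨h, rfl⟩
            · exact Or.inr (Or.inl ⟨h, rfl⟩)
            · exact Or.inr (Or.inr (Or.inl ⟨h, rfl⟩))
        · rcases Nat.lt_succ_iff_lt_or_eq.1 hi with hi' | rfl
          · exact Or.inl (Or.inr (Or.inr ⟨i, hi', h, rfl⟩))
          · exact Or.inr (Or.inr (Or.inr ⟨h, rfl⟩))
  have hconf : {e : Sym2 V | ((w e : unitInterval) : ℝ) = 1} = ↑(dfConf a b c d m) := by
    ext e
    simp only [Set.mem_setOf_eq, Finset.mem_coe, hmem m le_rfl]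
    constructor
    · intro h1
      have hne : w e ≠ 0 := by intro h0; rw [h0] at h1; norm_num at h1
      have he : e ∈ dfPairs a b c m := by by_contra hc; exact hne (hsupp e hc)
      rcases (mem_dfPairs_iff a b c m e).1 he with rfl | ⟨j, hj, rfl | rfl⟩ | ⟨j, hj, rfl⟩
      · left; exact ⟨by simp only [hd, wR, decide_eq_true_eq]; exact h1, rfl⟩
      · right; left; exact ⟨j, hj, Or.inl ⟨by simp only [hd, wR, decide_eq_true_eq]; exact h1, rfl⟩⟩
      · right; left; exact ⟨j, hj, Or.inr ⟨by simp only [hd, wR, decide_eq_true_eq]; exact h1, rfl⟩⟩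
      · right; right; exact ⟨j, hj, by simp only [hd, wR, decide_eq_true_eq]; exact h1, rfl⟩
    · rintro (⟨h, rfl⟩ | ⟨j, _, ⟨h, rfl⟩ | ⟨h, rfl⟩⟩ | ⟨j, _, h, rfl⟩)
      · simp only [hd, wR, decide_eq_true_eq] at h; exact h
      · simp only [hd, wR, decide_eq_true_eq] at h; exact h
      · simp only [hd, wR, decide_eq_true_eq] at h; exact h
      · simp only [hd, wR, decide_eq_true_eq] at h; exact h
  obtain ⟨hk, -, -, -, -⟩ := dfConf_inv hab hinj hca hcb d m le_rfl
  rw [rcPartitionFunctionW_rigid_eq_pow w q hR, hconf]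
  congr 1
  omega

end Setting

end ThreeApex

end FK

end Summit.CriticalPhenomena.PercolationContinuityZ3.Theorems
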